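/- Free-seat work of EXTRA WIDTH SEAT `ym-line-cbag-p1-w4` (prover-ym-line-cbag-p1-w4-g2-0), route `EguchiKawaiDirectionLadder`
(ideator ym-idea-2, LINE 8), crux `TripleSmallBallMargin` (stmt-QuantumFields-27724): removes the invertibility hypothesis from
`…PolarDefect` / `…CompressionSplit` (S9 of the LEAD's v7 architecture must hold for EVERY link `X`, not only for those with an
invertible compression).  ROUTE-INDEPENDENT.  Nothing here bears on the Yang–Mills mass gap. -/
import Summits.QuantumFields.YangMills.Theorems.EguchiKawaiDirectionLadderRobustPairTransfer
import Mathlib.LinearAlgebra.Matrix.Charpoly.Coeff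
import HarnessLib

/-!
# Route `EguchiKawaiDirectionLadder`: unitary + low rank + small for an ARBITRARY square matrix

`exists_unitary_add_lowRank_add_small` (`…PolarDefect`) needs `M` invertible.  Here the hypothesis is removed at the price of a factor
`6` and an arbitrary `ε > 0` in the Frobenius slack: perturb `M ↦ M + τ·1` with `τ > 0` small and off the (finitely many) real roots of
`τ ↦ det(M + τ·1) = charpoly(−M)(τ)`, apply the invertible case to `M + τ·1` (whose defect is `D₁ + (D₂ − τ(M+M†) − τ²)`), and move
`τ·1` into the small part:

* `exists_unitary_add_lowRank_add_small'` — `1 − MM† = D₁ + D₂ ⇒ ∀ ε > 0, M = Θ + R + S`, `Θ` unitary, `rank R ≤ rank D₁`,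
  `Σ|S|² ≤ 6·Σ|D₂|² + ε`;
* `compression_eq_unitary_add_lowRank_add_small'` — the window/near/far form of `…CompressionSplit` for EVERY `U ∈ U(N)`:
  `U_II = Θ + R + S`, `rank R ≤ #near`, `Σ|S|² ≤ 6·(far mass)² + ε`.

HONEST FRAMING: linear algebra only.  The route bears on the barrier-ledger fact `EguchiKawaiBreakdown` only.
-/

set_option autoImplicit false

noncomputable section

open scoped Matrix ComplexOrder Matrix.Norms.L2Operator
open Literature.Barriers.QuantumFields

namespace Summit.QuantumFields.YangMills.Theorems.EguchiKawaiDirectionLadder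

variable {n : Type} [Fintype n] [DecidableEq n]

/-- There is an arbitrarily small `τ > 0` with `M + τ·1` invertible (the real roots of `charpoly(−M)` are finitely many). -/
theorem exists_small_shift_isUnit (M : Matrix n n ℂ) {δ : ℝ} (hδ : 0 < δ) :
    ∃ τ : ℝ, 0 < τ ∧ τ < δ ∧ IsUnit (M + ((τ : ℂ) • (1 : Matrix n n ℂ))) := by
  -- the bad set: real `τ` with `charpoly(−M)(τ) = 0`
  set p : Polynomial ℂ := (-M).charpoly with hp
  have hp0 : p ≠ 0 := (Matrix.charpoly_monic (-M)).ne_zero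
  have hfin : {τ : ℝ | p.IsRoot (τ : ℂ)}.Finite := by
    have h1 : {τ : ℝ | p.IsRoot (τ : ℂ)} = (fun τ : ℝ => (τ : ℂ)) ⁻¹' {z : ℂ | p.IsRoot z} := rfl
    rw [h1]
    exact (Polynomial.finite_setOf_isRoot hp0).preimage Complex.ofReal_injective.injOn
  obtain ⟨τ, hτI, hτbad⟩ := ((Set.Ioo_infinite hδ).sdiff hfin).nonempty
  refine ⟨τ, hτI.1, hτI.2, ?_⟩
  rw [Matrix.isUnit_iff_isUnit_det, isUnit_iff_ne_zero]
  have heval : p.eval (τ : ℂ) = (M + (τ : ℂ) • (1 : Matrix n n ℂ)).det := by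
    rw [hp, Matrix.eval_charpoly, sub_neg_eq_add, add_comm]
    congr 1
    rw [Matrix.scalar_apply, ← Matrix.smul_one_eq_diagonal]
  intro hdet
  exact hτbad (by simp only [Set.mem_setOf_eq, Polynomial.IsRoot.def, heval, hdet])

omit [DecidableEq n] in
/-- `Σ|(τ·1)_{ij}|²`-type bound: `Σ|(c • A)_{ij}|² = |c|² Σ|A_{ij}|²`. -/
theorem sum_norm_sq_smul (c : ℂ) (A : Matrix n n ℂ) :
    ∑ i, ∑ j, ‖(c • A) i j‖ ^ 2 = ‖c‖ ^ 2 * ∑ i, ∑ j, ‖A i j‖ ^ 2 := by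
  simp only [Matrix.smul_apply, smul_eq_mul, norm_mul, mul_pow, Finset.mul_sum]

/-- `Σ|1_{ij}|² = #n`. -/
theorem sum_norm_sq_one : ∑ i, ∑ j, ‖(1 : Matrix n n ℂ) i j‖ ^ 2 = Fintype.card n := by
  have h : ∀ i : n, ∑ j, ‖(1 : Matrix n n ℂ) i j‖ ^ 2 = 1 := by
    intro i
    rw [Finset.sum_eq_single i]
    · simp
    · intro j _ hji; simp [Matrix.one_apply_ne (Ne.symm hji)]
    · intro h; exact absurd (Finset.mem_univ i) h
  simp only [h, Finset.sum_const, Finset.card_univ, nsmul_eq_mul, mul_one]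

/-- **Unitary + low rank + small, general square matrix.**  If `1 − MM† = D₁ + D₂` then for every `ε > 0`:
`M = Θ + R + S` with `Θ` unitary, `rank R ≤ rank D₁`, `Σ|S_{ij}|² ≤ 6·Σ|(D₂)_{ij}|² + ε`. -/
theorem exists_unitary_add_lowRank_add_small' (M D₁ D₂ : Matrix n n ℂ) (hD : 1 - M * Mᴴ = D₁ + D₂) {ε : ℝ} (hε : 0 < ε) :
    ∃ Θ R S : Matrix n n ℂ, Θ ∈ Matrix.unitaryGroup n ℂ ∧ R.rank ≤ D₁.rank ∧
      ∑ i, ∑ j, ‖S i j‖ ^ 2 ≤ 6 * ∑ i, ∑ j, ‖D₂ i j‖ ^ 2 + ε ∧ M = Θ + R + S := by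
  -- sizes entering the choice of `τ`
  set K : ℝ := ∑ i, ∑ j, ‖(M + Mᴴ) i j‖ ^ 2 with hK
  have hK0 : 0 ≤ K := Finset.sum_nonneg fun _ _ => Finset.sum_nonneg fun _ _ => by positivity
  set c : ℝ := 6 * K + 8 * Fintype.card n + 1 with hc
  have hc0 : 0 < c := by rw [hc]; positivity
  -- choose `τ ∈ (0, δ)` with `δ ≤ 1` and `δ² · c ≤ ε`
  set δ : ℝ := min 1 (Real.sqrt (ε / c)) with hδdef
  have hδ0 : 0 < δ := lt_min one_pos (Real.sqrt_pos.2 (div_pos hε hc0))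
  obtain ⟨τ, hτ0, hτδ, hunit⟩ := exists_small_shift_isUnit M hδ0
  have hτ1 : τ ≤ 1 := (hτδ.le.trans (min_le_left _ _))
  have hτsq : τ ^ 2 * c ≤ ε := by
    have h1 : τ ≤ Real.sqrt (ε / c) := hτδ.le.trans (min_le_right _ _)
    have h2 : τ ^ 2 ≤ ε / c := by
      calc τ ^ 2 ≤ Real.sqrt (ε / c) ^ 2 := pow_le_pow_left₀ hτ0.le h1 2
        _ = ε / c := Real.sq_sqrt (div_pos hε hc0).le
    calc τ ^ 2 * c ≤ ε / c * c := by gcongr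
      _ = ε := div_mul_cancel₀ ε hc0.ne'
  -- the shifted matrix and its defect
  set Mτ : Matrix n n ℂ := M + (τ : ℂ) • (1 : Matrix n n ℂ) with hMτ
  set D₂' : Matrix n n ℂ := D₂ + (-((τ : ℂ) • (M + Mᴴ))) + (-(((τ : ℂ) ^ 2) • (1 : Matrix n n ℂ))) with hD₂'
  have hDτ : 1 - Mτ * Mτᴴ = D₁ + D₂' := by
    have hconj : ((τ : ℂ) • (1 : Matrix n n ℂ))ᴴ = (τ : ℂ) • (1 : Matrix n n ℂ) := by
      rw [Matrix.conjTranspose_smul, Matrix.conjTranspose_one, Complex.star_def, Complex.conj_ofReal]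
    have h1 : Mτ * Mτᴴ = M * Mᴴ + (τ : ℂ) • (M + Mᴴ) + ((τ : ℂ) ^ 2) • (1 : Matrix n n ℂ) := by
      rw [hMτ, Matrix.conjTranspose_add, hconj]
      simp only [Matrix.add_mul, Matrix.mul_add, Matrix.mul_smul, Matrix.smul_mul, Matrix.mul_one, Matrix.one_mul,
        smul_add, smul_smul, sq]
      abel
    rw [h1, hD₂']
    have h2 : 1 - M * Mᴴ = D₁ + D₂ := hD
    rw [show (1 : Matrix n n ℂ) - (M * Mᴴ + (τ : ℂ) • (M + Mᴴ) + ((τ : ℂ) ^ 2) • (1 : Matrix n n ℂ)) =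
      (1 - M * Mᴴ) - (τ : ℂ) • (M + Mᴴ) - ((τ : ℂ) ^ 2) • (1 : Matrix n n ℂ) by abel, h2]
    abel
  obtain ⟨Θ, R, S', hΘ, hR, hS', hMeq⟩ := exists_unitary_add_lowRank_add_small Mτ D₁ D₂' hunit hDτ
  refine ⟨Θ, R, S' - (τ : ℂ) • (1 : Matrix n n ℂ), hΘ, hR, ?_, ?_⟩
  · -- Frobenius bookkeeping
    have hτnorm : ‖(τ : ℂ)‖ = τ := by rw [Complex.norm_real, Real.norm_eq_abs, abs_of_pos hτ0]
    have hD₂'le : ∑ i, ∑ j, ‖D₂' i j‖ ^ 2 ≤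
        3 * (∑ i, ∑ j, ‖D₂ i j‖ ^ 2 + τ ^ 2 * K + τ ^ 4 * Fintype.card n) := by
      have h := sum_norm_sq_add_three_le D₂ (-((τ : ℂ) • (M + Mᴴ))) (-(((τ : ℂ) ^ 2) • (1 : Matrix n n ℂ)))
      have e1 : ∑ i, ∑ j, ‖(-((τ : ℂ) • (M + Mᴴ))) i j‖ ^ 2 = τ ^ 2 * K := by
        simp only [Matrix.neg_apply, norm_neg]
        rw [sum_norm_sq_smul, hτnorm]
      have e2 : ∑ i, ∑ j, ‖(-(((τ : ℂ) ^ 2) • (1 : Matrix n n ℂ))) i j‖ ^ 2 = τ ^ 4 * Fintype.card n := by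
        simp only [Matrix.neg_apply, norm_neg]
        rw [sum_norm_sq_smul, sum_norm_sq_one, norm_pow, hτnorm]; ring
      rw [e1, e2] at h
      rw [hD₂']; exact h
    have hSle : ∑ i, ∑ j, ‖(S' - (τ : ℂ) • (1 : Matrix n n ℂ)) i j‖ ^ 2 ≤
        2 * (∑ i, ∑ j, ‖S' i j‖ ^ 2 + τ ^ 2 * Fintype.card n) := by
      have h := sum_norm_sq_sub_le S' ((τ : ℂ) • (1 : Matrix n n ℂ))
      rw [sum_norm_sq_smul, sum_norm_sq_one, hτnorm] at h
      exact h
    have hτ4 : τ ^ 4 ≤ τ ^ 2 := by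
      have : τ ^ 2 ≤ 1 := by nlinarith
      nlinarith [sq_nonneg τ]
    have hcard : (0 : ℝ) ≤ Fintype.card n := Nat.cast_nonneg _
    have hD₂0 : 0 ≤ ∑ i, ∑ j, ‖D₂ i j‖ ^ 2 := Finset.sum_nonneg fun _ _ => Finset.sum_nonneg fun _ _ => by positivity
    -- assemble: `2(3(ΣD₂ + τ²K + τ⁴n) + τ²n) ≤ 6ΣD₂ + τ²(6K + 8n) ≤ 6ΣD₂ + ε`
    have : 2 * (3 * (∑ i, ∑ j, ‖D₂ i j‖ ^ 2 + τ ^ 2 * K + τ ^ 4 * Fintype.card n) + τ ^ 2 * Fintype.card n) ≤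
        6 * ∑ i, ∑ j, ‖D₂ i j‖ ^ 2 + ε := by
      rw [hc] at hτsq
      nlinarith [mul_le_mul_of_nonneg_right hτ4 hcard]
    linarith [hS', hSle, hD₂'le]
  · have hM' : M = Mτ - (τ : ℂ) • (1 : Matrix n n ℂ) := by rw [hMτ]; abel
    rw [hM', hMeq]; abel

/-- **Compression of ANY unitary = unitary + low rank + small** (window/near/far labelling `c : Fin N → Fin 3`; no invertibility):
`U_II = Θ + R + S`, `rank R ≤ #{c = 1}`, `Σ|S|² ≤ 6·(Σ_{i∈I, c j = 2}|U_{ij}|²)² + ε`. -/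
theorem compression_eq_unitary_add_lowRank_add_small' {N : ℕ} (U : UN N) (c : Fin N → Fin 3) {ε : ℝ} (hε : 0 < ε) :
    ∃ Θ R S : Matrix {j : Fin N // c j = 0} {j : Fin N // c j = 0} ℂ,
      Θ ∈ Matrix.unitaryGroup {j : Fin N // c j = 0} ℂ ∧
        R.rank ≤ Fintype.card {j : Fin N // c j = 1} ∧
          ∑ i, ∑ j, ‖S i j‖ ^ 2 ≤
            6 * (∑ i, ∑ j, ‖(U : Matrix (Fin N) (Fin N) ℂ).toBlock (fun j => c j = 0) (fun j => c j = 2) i j‖ ^ 2) ^ 2 + ε ∧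
          (U : Matrix (Fin N) (Fin N) ℂ).toBlock (fun j => c j = 0) (fun j => c j = 0) = Θ + R + S := by
  set M := (U : Matrix (Fin N) (Fin N) ℂ).toBlock (fun j => c j = 0) (fun j => c j = 0) with hM
  set A₁ := (U : Matrix (Fin N) (Fin N) ℂ).toBlock (fun j => c j = 0) (fun j => c j = 1) with hA₁
  set A₂ := (U : Matrix (Fin N) (Fin N) ℂ).toBlock (fun j => c j = 0) (fun j => c j = 2) with hA₂
  have hsplit : 1 - M * Mᴴ = A₁ * A₁ᴴ + A₂ * A₂ᴴ := by
    have h := one_sub_compression_gram_eq_sum U c 0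
    rw [h]
    have huniv : (Finset.univ : Finset (Fin 3)).erase 0 = {1, 2} := by decide
    rw [huniv, Finset.sum_pair (by decide)]
  obtain ⟨Θ, R, S, hΘ, hR, hS, hMeq⟩ := exists_unitary_add_lowRank_add_small' M (A₁ * A₁ᴴ) (A₂ * A₂ᴴ) hsplit hε
  refine ⟨Θ, R, S, hΘ, hR.trans (rank_mul_conjTranspose_le_card A₁), hS.trans ?_, hMeq⟩
  have := sum_norm_sq_mul_conjTranspose_le_sq A₂
  linarith

end Summit.QuantumFields.YangMills.Theorems.EguchiKawaiDirectionLadder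

end
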